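import Literature.NumberTheory.GaloisRepresentations.IdeleClassModUnitsSInflation
import HarnessLib

/-!
# Harari's `C_S(E) = C_E ⧸ U_{E,S}` element-wise: the quotient map `π : C_E ↠ C_S(E)` is onto with kernel exactly the
# image of `U_{E,S}` (Harari Def. 15.38; NSW (8.3.8))

Topic `NumberTheory/GaloisRepresentations`; namespace `Literature.NumberTheory.GaloisRepresentations.IdeleCohomology`.
Sequel to `IdeleClassModUnitsS.lean` (`classModUnitsRep F E S := cokernel (unitsOffToClass S)` in the abelian category
`Rep ℤ Gal(E/F)`, the short exact sequence `0 → U_{E,S} → C_E → C_S(E) → 0`) and to bsd-line-x1-p1-w4's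
`IdeleClassModUnitsSInflation.lean` (`cokernel_π_unitsOffToClass_surjective`: `π` is onto).  One definition with body (`classModUnitsπ`,
the quotient map as a bare additive map — plumbing) and theorems; NO named fact, no instance, no notation, no `sorry`.
Cell `bsd-eis`, background lane «PT-Ш-S-TC», brick D1-(ii) (part 5a), written `--supports` crux `GoodLatticeBDPValue`
(stmt-BirchSwinnertonDyer-19032).  HONEST FRAMING: bookkeeping; no duality theorem and no case of BSD is proved here.

Mathematics.  `C_S(E) := C_E / U_{E,S}` (Harari Def. 15.38) is realised in the tree as an ABSTRACT cokernel; to compare it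
with the layers `C̄_S^{Gal(K_S/E)}` of the `S`-idèle class module (`IdeleClassBarSRestrictedLayers.lean`) one needs it
element-wise: `π = cokernel.π : C_E → C_S(E)` is surjective (an epimorphism of `Rep`; in the tree), and **`π c = 0 ↔ c ∈ im(U_{E,S} → C_E)`**
— proved WITHOUT the forgetful functor to `ModuleCat` (whose `ConcreteCategory` structure on `Rep ℤ G` does not
elaborate for `k = ℤ`, the `ℤ`-module structure of an abstract `Rep` object not being the canonical one): `π` factors
(universal property of the cokernel) through the explicit quotient representation `C_E ⧸ im U_{E,S}` (Mathlib
`Representation.quotient`), in which the class of `c` vanishes iff `c ∈ im U_{E,S}`.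

## What is formalised (`F ⊆ E` number fields, `S : Finset (HeightOneSpectrum (𝓞 F))`)
* **`classModUnits_π_eq_zero_iff`**, `classModUnits_π_eq_iff`;
* `classModUnitsπ S : C_E →+ C_S(E)` (+ `classModUnitsπ_apply`, `classModUnitsπ_surjective`, `mem_ker_classModUnitsπ_iff`).

## References
* D. Harari, *Galois Cohomology and Class Field Theory*, Universitext (2020), Def. 15.38. [Harari2020]
* J. Neukirch, A. Schmidt, K. Wingberg, *Cohomology of Number Fields*, 2nd ed. (2008), VIII §3 (8.3.8). [NeukirchSchmidtWingberg2008]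
-/

noncomputable section

open NumberField IsDedekindDomain CategoryTheory CategoryTheory.Limits
open Literature.NumberTheory.Automorphic

namespace Literature.NumberTheory.GaloisRepresentations

/-! ## §1. The abstract cokernel `C_S(E) = coker(U_{E,S} → C_E)` element-wise -/

namespace IdeleCohomology

variable {F E : Type} [Field F] [NumberField F] [Field E] [NumberField E] [Algebra F E]
  (S : Finset (HeightOneSpectrum (𝓞 F)))

/-- **The kernel of `π : C_E → C_S(E)` is exactly the image of `U_{E,S}`**: `π` factors through the explicit quotient
`C_E ⧸ im U_{E,S}` (universal property of the cokernel), where the class of `c` vanishes iff `c ∈ im U_{E,S}`.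
[cite: Harari2020, Def. 15.38] -/
theorem classModUnits_π_eq_zero_iff (c : (IdeleClassGroup.galoisRep F E).V) :
    (cokernel.π (unitsOffToClass (F := F) (E := E) S)).hom c = 0 ↔
      c ∈ (unitsOffToClass (F := F) (E := E) S).hom.range := by
  constructor
  · intro hc
    -- the explicit quotient representation `C_E ⧸ im U_{E,S}` and the projection onto it
    let W := (unitsOffToClass (F := F) (E := E) S).hom.range.toSubmodule
    have hW : ∀ g : E ≃ₐ[F] E, W ≤ W.comap ((IdeleClassGroup.galoisRep F E).ρ g) := fun g x hx =>
      (unitsOffToClass (F := F) (E := E) S).hom.range.apply_mem_toSubmodule g hx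
    let q : IdeleClassGroup.galoisRep F E ⟶ Rep.of ((IdeleClassGroup.galoisRep F E).ρ.quotient W hW) :=
      Rep.ofHom (LinearMap.intertwiningMap_of_isIntertwiningMap (IdeleClassGroup.galoisRep F E).ρ
        ((IdeleClassGroup.galoisRep F E).ρ.quotient W hW) W.mkQ fun _ _ => rfl)
    have hq : unitsOffToClass (F := F) (E := E) S ≫ q = 0 :=
      Rep.hom_ext (Representation.IntertwiningMap.ext (LinearMap.ext fun u =>
        (Submodule.Quotient.mk_eq_zero W).2 ⟨u, rfl⟩))
    -- `π c = 0` forces `q c = desc (π c) = 0`, i.e. `c ∈ im U_{E,S}`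
    have h1 : q.hom c = 0 := by
      have h := congrArg (fun φ : IdeleClassGroup.galoisRep F E ⟶ _ => φ.hom c)
        (cokernel.π_desc (unitsOffToClass (F := F) (E := E) S) q hq)
      change (cokernel.desc _ q hq).hom ((cokernel.π (unitsOffToClass (F := F) (E := E) S)).hom c) = q.hom c at h
      rw [← h, hc, map_zero]
    exact (Submodule.Quotient.mk_eq_zero W).1 h1
  · rintro ⟨u, rfl⟩
    change (unitsOffToClass (F := F) (E := E) S ≫ cokernel.π (unitsOffToClass (F := F) (E := E) S)).hom u = 0
    rw [cokernel.condition, Rep.zero_hom]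
    rfl

/-- `π c = π c' ↔ c - c' ∈ im U_{E,S}`. [cite: Harari2020, Def. 15.38] -/
theorem classModUnits_π_eq_iff (c c' : (IdeleClassGroup.galoisRep F E).V) :
    (cokernel.π (unitsOffToClass (F := F) (E := E) S)).hom c =
        (cokernel.π (unitsOffToClass (F := F) (E := E) S)).hom c' ↔
      c - c' ∈ (unitsOffToClass (F := F) (E := E) S).hom.range := by
  rw [← sub_eq_zero, ← map_sub, classModUnits_π_eq_zero_iff]

/-- **`π : C_E →+ C_S(E)` as an additive map** (the coercion of `cokernel.π`; kept free of the `ℤ`-module structures so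
that it composes with additive descent). [cite: Harari2020, Def. 15.38] -/
def classModUnitsπ : (IdeleClassGroup.galoisRep F E).V →+ (classModUnitsRep F E S).V :=
  AddMonoidHom.mk' (fun c => (cokernel.π (unitsOffToClass (F := F) (E := E) S)).hom c) fun x y => map_add _ x y

/-- Formula: `classModUnitsπ c = π c`. [cite: Harari2020, Def. 15.38] -/
@[simp] theorem classModUnitsπ_apply (c : (IdeleClassGroup.galoisRep F E).V) :
    classModUnitsπ S c = (cokernel.π (unitsOffToClass (F := F) (E := E) S)).hom c := rfl

/-- `classModUnitsπ` is onto. [cite: Harari2020, Def. 15.38] -/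
theorem classModUnitsπ_surjective : Function.Surjective (classModUnitsπ (F := F) (E := E) S) :=
  cokernel_π_unitsOffToClass_surjective (F := F) (E := E) S

/-- The kernel of `classModUnitsπ` is `im U_{E,S}`. [cite: Harari2020, Def. 15.38] -/
theorem mem_ker_classModUnitsπ_iff (c : (IdeleClassGroup.galoisRep F E).V) :
    c ∈ (classModUnitsπ (F := F) (E := E) S).ker ↔ c ∈ (unitsOffToClass (F := F) (E := E) S).hom.range :=
  (AddMonoidHom.mem_ker).trans (classModUnits_π_eq_zero_iff S c)

end IdeleCohomology

end Literature.NumberTheory.GaloisRepresentations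

end
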